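import Summits.QuantumFields.BalabanUV.Beta.MultiscaleGradientCommutator

/-!
# `Summit.QuantumFields.BalabanUV.Beta.MultiscaleGradientForward` — engine file 20e: the FORWARD commutator of the covariant derivative
# with the conjugation — `Σ_i (D e^{φ}v)(b,i)² ≤ 2e^{2φ(b₋)}Σ_i(Dv)(b,i)² + 2c_b²(eθ_b)²‖(e^{φ}v)(b₊)‖²` for every isometric bond matrix,
# and its sum over a bond set with a ceiling on `φ` — the source-side tool of the mixed ℓ² member (3.46)₅ (file 20f)

HONEST FRAMING (page 1 of everything in this cell).  Discharging `FlowStep.BetaPertH` would make Bałaban's ultraviolet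
stability UNCONDITIONAL — a constructive-QFT result; it is NOT the continuum limit and NOT the Clay problem.  This module
discharges nothing of `BetaPertH`; it is [folklore] finite-dimensional bookkeeping about the MODEL operator, kernel-checked, by the
OWNER of binder row D4 (unit `b2b-balaban-beta-an4`, gen 46).  HONEST DEPENDENCY: continuum YM on T⁴ ⇐ BetaPertH ∧ nine spine
estimates (0/9 proved); BetaPertH ⇐ (D1) ∧ (D4) ∧ CAP+tail; G-an2-4 gates asym, D1 and NE2/3/4.

THE POINT.  File 20b's `sum_sq_exp_covD_le` reads the commutator identity `covD_expW` BACKWARDS (`e^{φ(b₋)}Dw` in terms of `D(e^{φ}w)`),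
which is what the TARGET side of an ℓ² member needs.  When the SOURCE of the equation is itself a divergence `D*λ`, the conjugated
pairing becomes `⟨D(e^{φ}g), λ⟩` and one needs the identity read FORWARDS: §1 `sum_sq_covD_expW_le`; §2 `bond_sum_forward_le` sums it
over a bond set on whose sources `φ ≤ Φ₀` (`θ_b = κ·slen(b) ≤ κ/n(b₊)`, at most `d` bonds per target):
`Σ_{b∈Bd}Σ_i (D e^{φ}v)² ≤ 2e^{2Φ₀}(Σ_q (Dv)(q)² + c_max²e⁴κ²·d·Σ_x n(x)⁻²‖v(x)‖²)`.  WHAT THIS IS NOT: nothing of Bałaban's G′(U);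
(3.3)∕(3.46) are LOCATORS; row D4 readiness width 0; D4 DISCHARGE NO DATE.

WHAT IS CERTIFIED (kernel, 0 sorry, 0 def): `sum_sq_covD_expW_le`, `bond_sum_forward_le`.  LOCATORS (shape only; ABSOLUTE RULE —
nothing printed is asserted): [Balaban1985BackgroundPropagators] (3.3) pp. 390–391, Thm 3.1 (3.46) p. 398.  NOT BetaPertH, NOT
continuum, NOT Clay, NOT summit progress.
-/

open scoped BigOperators
open Finset

namespace Summit.QuantumFields.BalabanUV.Beta.MultiscaleGradientForward

open Summit.QuantumFields.BalabanUV.Beta.BoxPoincare (Box)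
open Summit.QuantumFields.BalabanUV.Beta.MultiscaleCoerciveTorus
open Summit.QuantumFields.BalabanUV.Beta.MultiscaleConjError (siteSq siteSq_nonneg)
open Summit.QuantumFields.BalabanUV.Beta.MultiscaleDistance
open Summit.QuantumFields.BalabanUV.Beta.MultiscaleDecayBudget
open Summit.QuantumFields.BalabanUV.Beta.MultiscaleDecay (hc_levelOp decay_levelOp)
open Summit.QuantumFields.BalabanUV.Beta.MultiscaleGradientCoercive (hgrad_levelOp)
open Summit.QuantumFields.BalabanUV.Beta.MultiscaleGradientCommutator (covD_expW bond_sum_commutator_le)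
open Summit.QuantumFields.BalabanUV.Beta.MultiscaleAveragingPointwise (isometry_sq_sum)
open Summit.QuantumFields.BalabanUV.Beta.AccretiveCombesThomasSandwichSite (sdist_corner_thresholds)
open Literature.MathematicalPhysics.QuantumFieldTheory.Balaban1983to89
open Literature.MathematicalPhysics.QuantumFieldTheory.Balaban1983to89.B9Thm37Glue (covD covDT covD_apply sum_covDT_mul)
open Literature.MathematicalPhysics.QuantumFieldTheory.Balaban1983to89.B9Thm37GluePU (bsrc btgt bsrc_apply btgt_apply)
open Literature.MathematicalPhysics.QuantumFieldTheory.Balaban1983to89.B9Thm37GlueTorusCov (tblk)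
open Literature.MathematicalPhysics.QuantumFieldTheory.Balaban1983to89.B9Thm37GlueTorusCovLevels (levelOp)
open Literature.MathematicalPhysics.QuantumFieldTheory.Balaban1983to89.B9Thm37GlueTorusCovCT (expW expW_apply
  sum_comp_le_of_card_fiber_le card_filter_btgt_le)
open Summit.QuantumFields.BalabanUV.T4Continuum.RegionGaugeSliceOrth (le_of_le_sqrt_mul_sqrt)
open B5TorusCover (UT Ctr ctrU)

noncomputable section

/-! ## §1 The FORWARD commutator bound: `D(e^{φ}v)` in terms of `e^{φ(b₋)}Dv` and the mass of `e^{φ}v` -/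

section Forward

variable {St Bd Cp : Type} [Fintype Cp] [DecidableEq Cp] (src tgt : Bd → St) (c : Bd → ℝ) (Rm : Bd → Cp → Cp → ℝ)

/-- **THE FORWARD SQUARE BOUND OF THE COMMUTATOR, SUMMED OVER THE FIBRE.**  For an isometric `R_b` and `|φ(b₊) − φ(b₋)| ≤ θ_b ≤ 1`:
`Σ_i (D e^{φ}v)(b,i)² ≤ 2e^{2φ(b₋)}Σ_i (Dv)(b,i)² + 2c_b²(eθ_b)²·Σ_j (e^{φ}v)(b₊,j)²`
(`(D e^{φ}v)(b,i) = e^{φ(b₋)}(Dv)(b,i) + c_b(1 − e^{φ(b₋)−φ(b₊)})(R_b(e^{φ}v)(b₊))_i`, `|1 − e^{φ(b₋)−φ(b₊)}| ≤ eθ_b`). [folklore] -/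
theorem sum_sq_covD_expW_le (hRmb : ∀ b i j, ∑ k, Rm b k i * Rm b k j = if i = j then (1 : ℝ) else 0) (φ : St → ℝ)
    (v : St × Cp → ℝ) (b : Bd) {θ : ℝ} (hθ0 : 0 ≤ θ) (hθ1 : θ ≤ 1) (hφ : |φ (tgt b) - φ (src b)| ≤ θ) :
    ∑ i, (covD src tgt c Rm (expW φ v) (b, i)) ^ 2 ≤
      2 * (Real.exp (φ (src b)) ^ 2 * ∑ i, (covD src tgt c Rm v (b, i)) ^ 2) +
        2 * (c b ^ 2 * (Real.exp 1 * θ) ^ 2 * ∑ j, (expW φ v (tgt b, j)) ^ 2) := by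
  have hsq2 : ∀ x y : ℝ, (x + y) ^ 2 ≤ 2 * x ^ 2 + 2 * y ^ 2 := fun x y => by nlinarith [sq_nonneg (x - y)]
  set δ : ℝ := 1 - Real.exp (φ (src b) - φ (tgt b)) with hδ
  have hδabs : |δ| ≤ Real.exp 1 * θ := by
    set x : ℝ := φ (src b) - φ (tgt b) with hx
    have hxθ : |x| ≤ θ := by rw [hx, abs_sub_comm]; exact hφ
    have h1 : |1 - Real.exp x| ≤ Real.exp |x| - 1 := by
      rw [abs_sub_le_iff]
      constructor
      · have hx' : -|x| ≤ x := neg_abs_le x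
        have h2 : Real.exp (-|x|) ≤ Real.exp x := Real.exp_le_exp.mpr hx'
        have h3 : Real.exp (-|x|) * Real.exp |x| = 1 := by rw [← Real.exp_add]; simp
        have h4 : 0 < Real.exp |x| := Real.exp_pos _
        nlinarith [Real.add_one_le_exp (|x|), Real.add_one_le_exp (-|x|), abs_nonneg x]
      · have : Real.exp x ≤ Real.exp |x| := Real.exp_le_exp.mpr (le_abs_self x)
        linarith
    have h2 : Real.exp |x| - 1 ≤ |x| * Real.exp |x| := by
      have ht := abs_nonneg x
      have h := Real.add_one_le_exp (-|x|)
      have hpos : 0 < Real.exp |x| := Real.exp_pos _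
      have h3 : Real.exp (-|x|) * Real.exp |x| = 1 := by rw [← Real.exp_add]; simp
      nlinarith
    have h3 : |x| * Real.exp |x| ≤ θ * Real.exp 1 :=
      mul_le_mul hxθ (Real.exp_le_exp.mpr (hxθ.trans hθ1)) (Real.exp_pos _).le hθ0
    calc |δ| = |1 - Real.exp x| := by rw [hδ]
      _ ≤ θ * Real.exp 1 := (h1.trans h2).trans h3
      _ = Real.exp 1 * θ := mul_comm _ _
  -- bondwise identity, forward: `(D e^φ v)(b,i) = e^{φ(b₋)}(Dv)(b,i) + c_b δ Σ_j R_{ij} (e^φ v)(b₊,j)`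
  have hid : ∀ i, covD src tgt c Rm (expW φ v) (b, i) =
      Real.exp (φ (src b)) * covD src tgt c Rm v (b, i) + c b * δ * ∑ j, Rm b i j * expW φ v (tgt b, j) := by
    intro i
    rw [covD_expW src tgt c Rm φ v b i, hδ]
    simp only [expW]
    have h : ∑ j, Rm b i j * (Real.exp (φ (tgt b)) * v (tgt b, j)) = Real.exp (φ (tgt b)) * ∑ j, Rm b i j * v (tgt b, j) := by
      rw [Finset.mul_sum]; exact Finset.sum_congr rfl fun j _ => by ring
    rw [h]
    have e1 : Real.exp (φ (src b) - φ (tgt b)) * Real.exp (φ (tgt b)) = Real.exp (φ (src b)) := by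
      rw [← Real.exp_add]; ring_nf
    have : c b * (1 - Real.exp (φ (src b) - φ (tgt b))) * (Real.exp (φ (tgt b)) * ∑ j, Rm b i j * v (tgt b, j)) =
        c b * (Real.exp (φ (tgt b)) - Real.exp (φ (src b))) * ∑ j, Rm b i j * v (tgt b, j) := by
      have : (1 - Real.exp (φ (src b) - φ (tgt b))) * Real.exp (φ (tgt b)) = Real.exp (φ (tgt b)) - Real.exp (φ (src b)) := by
        rw [sub_mul, one_mul, e1]
      calc c b * (1 - Real.exp (φ (src b) - φ (tgt b))) * (Real.exp (φ (tgt b)) * ∑ j, Rm b i j * v (tgt b, j))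
          = c b * ((1 - Real.exp (φ (src b) - φ (tgt b))) * Real.exp (φ (tgt b))) * ∑ j, Rm b i j * v (tgt b, j) := by ring
        _ = _ := by rw [this]
    rw [this]
  have hiso : ∑ i, (∑ j, Rm b i j * expW φ v (tgt b, j)) ^ 2 = ∑ j, (expW φ v (tgt b, j)) ^ 2 :=
    isometry_sq_sum (Rm b) (hRmb b) (fun j => expW φ v (tgt b, j))
  calc ∑ i, (covD src tgt c Rm (expW φ v) (b, i)) ^ 2
      = ∑ i, (Real.exp (φ (src b)) * covD src tgt c Rm v (b, i) + c b * δ * ∑ j, Rm b i j * expW φ v (tgt b, j)) ^ 2 :=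
        Finset.sum_congr rfl fun i _ => by rw [hid i]
    _ ≤ ∑ i, (2 * (Real.exp (φ (src b)) * covD src tgt c Rm v (b, i)) ^ 2 +
          2 * (c b * δ * ∑ j, Rm b i j * expW φ v (tgt b, j)) ^ 2) :=
        Finset.sum_le_sum fun i _ => hsq2 _ _
    _ = 2 * (Real.exp (φ (src b)) ^ 2 * ∑ i, (covD src tgt c Rm v (b, i)) ^ 2) +
          2 * ((c b * δ) ^ 2 * ∑ i, (∑ j, Rm b i j * expW φ v (tgt b, j)) ^ 2) := by
        rw [Finset.sum_add_distrib, ← Finset.mul_sum, ← Finset.mul_sum, Finset.mul_sum (s := univ) (f := fun i =>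
          (∑ j, Rm b i j * expW φ v (tgt b, j)) ^ 2), Finset.mul_sum (s := univ) (f := fun i => (covD src tgt c Rm v (b, i)) ^ 2)]
        congr 1
        · congr 1; exact Finset.sum_congr rfl fun i _ => by ring
        · congr 1; exact Finset.sum_congr rfl fun i _ => by ring
    _ = 2 * (Real.exp (φ (src b)) ^ 2 * ∑ i, (covD src tgt c Rm v (b, i)) ^ 2) +
          2 * (c b ^ 2 * δ ^ 2 * ∑ j, (expW φ v (tgt b, j)) ^ 2) := by rw [hiso]; ring
    _ ≤ 2 * (Real.exp (φ (src b)) ^ 2 * ∑ i, (covD src tgt c Rm v (b, i)) ^ 2) +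
          2 * (c b ^ 2 * (Real.exp 1 * θ) ^ 2 * ∑ j, (expW φ v (tgt b, j)) ^ 2) := by
        have hδ2 : δ ^ 2 ≤ (Real.exp 1 * θ) ^ 2 := by
          rw [← sq_abs δ]; exact pow_le_pow_left₀ (abs_nonneg _) hδabs 2
        have hS : 0 ≤ ∑ j, (expW φ v (tgt b, j)) ^ 2 := Finset.sum_nonneg fun j _ => sq_nonneg _
        have := mul_le_mul_of_nonneg_left (mul_le_mul_of_nonneg_right hδ2 hS) (sq_nonneg (c b))
        nlinarith [this]

end Forward

/-! ## §2 The forward bound summed over a bond set with a ceiling on its sources (torus; `θ_b = κ·slen(b)`) -/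

section ForwardSum

variable {d : ℕ} {N : Fin d → ℕ} [∀ i, NeZero (N i)] {Cp J K : Type} [Fintype Cp] [DecidableEq Cp]
  (S : J → ℕ) (hS : ∀ l, 1 ≤ S l) (hdivS : ∀ l i, S l ∣ N i) (lvl : K → J) (zc : (k : K) → Ctr N (S (lvl k)))
  (hcover : ∀ x : UT N, ∃ k, ∃ v : Box d (S (lvl k)), cellPt S hS hdivS lvl zc k v = x)
  (Rm : UT N × Fin d → Cp → Cp → ℝ) (hRm : ∀ b i j, ∑ k, Rm b k i * Rm b k j = if i = j then (1 : ℝ) else 0)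
  (c : UT N × Fin d → ℝ) {cmax : ℝ} (hc : ∀ b, |c b| ≤ cmax) {κ : ℝ} (hκ0 : 0 ≤ κ) (hκ1 : κ ≤ 1)

include hRm hc hκ0 hκ1

/-- **THE FORWARD COMMUTATOR SUMMED OVER A BOND SET WITH A CEILING `Φ₀` ON ITS SOURCES.**  With `n` the site scale,
`|φ(b₊) − φ(b₋)| ≤ κ·slen(b)` on every bond (`0 ≤ κ ≤ 1`), `φ(b₋) ≤ Φ₀` for `b ∈ Bd` (hence `φ(b₊) ≤ Φ₀ + 1`), and `g = e^{φ}v`: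
`Σ_{b∈Bd}Σ_i (Dg)(b,i)² ≤ 2e^{2Φ₀}·(Σ_q (Dv)(q)² + c_max²e⁴κ²·d·Σ_x n(x)⁻²‖v(x)‖²)`. [folklore] -/
theorem bond_sum_forward_le (φ : UT N → ℝ)
    (hφ : ∀ b : UT N × Fin d, |φ (btgt b) - φ (bsrc b)| ≤ κ * slen (siteScale S hS hdivS lvl zc hcover) (bsrc b) (btgt b))
    (v : UT N × Cp → ℝ) (Bd : Finset (UT N × Fin d)) {Φ₀ : ℝ} (hΦ : ∀ b ∈ Bd, φ (bsrc b) ≤ Φ₀) :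
    ∑ b ∈ Bd, ∑ i, (covD bsrc btgt c Rm (expW φ v) (b, i)) ^ 2 ≤
      2 * Real.exp (2 * Φ₀) * (∑ q, (covD bsrc btgt c Rm v q) ^ 2 +
        cmax ^ 2 * Real.exp 1 ^ 4 * κ ^ 2 * (d * ∑ x, ((siteScale S hS hdivS lvl zc hcover x : ℝ) ^ 2)⁻¹ * siteSq v x)) := by
  classical
  set n := siteScale S hS hdivS lvl zc hcover with hn
  set g := expW φ v with hg
  have hd0 : (0 : ℝ) ≤ d := Nat.cast_nonneg _
  -- bondwise on `Bd`
  have hbond : ∀ b ∈ Bd, ∑ i, (covD bsrc btgt c Rm g (b, i)) ^ 2 ≤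
      2 * Real.exp (2 * Φ₀) * (∑ i, (covD bsrc btgt c Rm v (b, i)) ^ 2 +
        cmax ^ 2 * Real.exp 1 ^ 4 * κ ^ 2 * ((((n (btgt b) : ℝ)) ^ 2)⁻¹ * siteSq v (btgt b))) := by
    intro b hb
    have hθ0 : 0 ≤ κ * slen n (bsrc b) (btgt b) := mul_nonneg hκ0 (slen_nonneg n _ _)
    have hsl1 : slen n (bsrc b) (btgt b) ≤ 1 := slen_le_one n (one_le_siteScale S hS hdivS lvl zc hcover) _ _
    have hθ1 : κ * slen n (bsrc b) (btgt b) ≤ 1 := by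
      calc κ * slen n (bsrc b) (btgt b) ≤ 1 * 1 := mul_le_mul hκ1 hsl1 (slen_nonneg n _ _) zero_le_one
        _ = 1 := one_mul 1
    have h := sum_sq_covD_expW_le bsrc btgt c Rm hRm φ v b hθ0 hθ1 (hφ b)
    rw [← hg] at h
    have hc2 : c b ^ 2 ≤ cmax ^ 2 := by rw [← sq_abs (c b)]; exact pow_le_pow_left₀ (abs_nonneg _) (hc b) 2
    have hsl : slen n (bsrc b) (btgt b) ≤ ((n (btgt b) : ℝ))⁻¹ := (slen_bond_le bsrc btgt n b).2
    have hsl2 : slen n (bsrc b) (btgt b) ^ 2 ≤ (((n (btgt b) : ℝ)) ^ 2)⁻¹ := by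
      rw [← inv_pow]; exact pow_le_pow_left₀ (slen_nonneg n _ _) hsl 2
    -- `Σ_j g(b₊,j)² = e^{2φ(b₊)}·siteSq v (b₊) ≤ e^{2Φ₀+2}·siteSq v (b₊)`
    have hφt : φ (btgt b) ≤ Φ₀ + 1 := by
      have h1 := (abs_sub_le_iff.mp (hφ b)).1
      linarith [hΦ b hb]
    have hsite : ∑ j, (g (btgt b, j)) ^ 2 = Real.exp (φ (btgt b)) ^ 2 * siteSq v (btgt b) := by
      rw [hg]; unfold siteSq; rw [Finset.mul_sum]
      exact Finset.sum_congr rfl fun j _ => by rw [expW_apply, mul_pow]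
    have hsv := siteSq_nonneg v (btgt b)
    have hexpt : Real.exp (φ (btgt b)) ^ 2 ≤ Real.exp (2 * Φ₀) * Real.exp 1 ^ 2 := by
      rw [sq, ← Real.exp_add, sq, ← Real.exp_add, ← Real.exp_add]
      exact Real.exp_le_exp.mpr (by linarith)
    rw [hsite] at h
    have hDv0 : 0 ≤ ∑ i, (covD bsrc btgt c Rm v (b, i)) ^ 2 := Finset.sum_nonneg fun i _ => sq_nonneg _
    have hexp : Real.exp (φ (bsrc b)) ^ 2 ≤ Real.exp (2 * Φ₀) := by
      rw [sq, ← Real.exp_add]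
      exact Real.exp_le_exp.mpr (by linarith [hΦ b hb])
    -- the commutator coefficient
    have hcoef : c b ^ 2 * (Real.exp 1 * (κ * slen n (bsrc b) (btgt b))) ^ 2 * (Real.exp (φ (btgt b)) ^ 2 * siteSq v (btgt b)) ≤
        Real.exp (2 * Φ₀) * (cmax ^ 2 * Real.exp 1 ^ 4 * κ ^ 2 * ((((n (btgt b) : ℝ)) ^ 2)⁻¹ * siteSq v (btgt b))) := by
      have hin : slen n (bsrc b) (btgt b) ^ 2 * siteSq v (btgt b) ≤ (((n (btgt b) : ℝ)) ^ 2)⁻¹ * siteSq v (btgt b) :=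
        mul_le_mul_of_nonneg_right hsl2 hsv
      have h4 : c b ^ 2 * (Real.exp (φ (btgt b)) ^ 2) ≤ cmax ^ 2 * (Real.exp (2 * Φ₀) * Real.exp 1 ^ 2) :=
        mul_le_mul hc2 hexpt (sq_nonneg _) (sq_nonneg cmax)
      have hin0 : 0 ≤ slen n (bsrc b) (btgt b) ^ 2 * siteSq v (btgt b) := by positivity
      have e1 : c b ^ 2 * (Real.exp 1 * (κ * slen n (bsrc b) (btgt b))) ^ 2 * (Real.exp (φ (btgt b)) ^ 2 * siteSq v (btgt b)) =
          (c b ^ 2 * Real.exp (φ (btgt b)) ^ 2) * (Real.exp 1 ^ 2 * κ ^ 2) * (slen n (bsrc b) (btgt b) ^ 2 * siteSq v (btgt b)) := by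
        ring
      have e2 : Real.exp (2 * Φ₀) * (cmax ^ 2 * Real.exp 1 ^ 4 * κ ^ 2 * ((((n (btgt b) : ℝ)) ^ 2)⁻¹ * siteSq v (btgt b))) =
          (cmax ^ 2 * (Real.exp (2 * Φ₀) * Real.exp 1 ^ 2)) * (Real.exp 1 ^ 2 * κ ^ 2) *
            ((((n (btgt b) : ℝ)) ^ 2)⁻¹ * siteSq v (btgt b)) := by ring
      rw [e1, e2]
      exact mul_le_mul (mul_le_mul_of_nonneg_right h4 (by positivity)) hin hin0 (by positivity)
    have hA := mul_le_mul_of_nonneg_right hexp hDv0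
    calc ∑ i, (covD bsrc btgt c Rm g (b, i)) ^ 2
        ≤ 2 * (Real.exp (φ (bsrc b)) ^ 2 * ∑ i, (covD bsrc btgt c Rm v (b, i)) ^ 2) +
            2 * (c b ^ 2 * (Real.exp 1 * (κ * slen n (bsrc b) (btgt b))) ^ 2 *
              (Real.exp (φ (btgt b)) ^ 2 * siteSq v (btgt b))) := h
      _ ≤ 2 * (Real.exp (2 * Φ₀) * ∑ i, (covD bsrc btgt c Rm v (b, i)) ^ 2) +
            2 * (Real.exp (2 * Φ₀) * (cmax ^ 2 * Real.exp 1 ^ 4 * κ ^ 2 * ((((n (btgt b) : ℝ)) ^ 2)⁻¹ * siteSq v (btgt b)))) := by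
          linarith [hA, hcoef]
      _ = 2 * Real.exp (2 * Φ₀) * (∑ i, (covD bsrc btgt c Rm v (b, i)) ^ 2 +
            cmax ^ 2 * Real.exp 1 ^ 4 * κ ^ 2 * ((((n (btgt b) : ℝ)) ^ 2)⁻¹ * siteSq v (btgt b))) := by ring
  -- sum over `Bd ⊆ univ` and count fibres of `btgt`
  have hsumD : ∑ b : UT N × Fin d, ∑ i, (covD bsrc btgt c Rm v (b, i)) ^ 2 = ∑ q, (covD bsrc btgt c Rm v q) ^ 2 :=
    (Fintype.sum_prod_type (fun q : (UT N × Fin d) × Cp => (covD bsrc btgt c Rm v q) ^ 2)).symm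
  have hfib : ∑ b : UT N × Fin d, ((n (btgt b) : ℝ) ^ 2)⁻¹ * siteSq v (btgt b) ≤ d * ∑ x, ((n x : ℝ) ^ 2)⁻¹ * siteSq v x :=
    sum_comp_le_of_card_fiber_le btgt card_filter_btgt_le (fun x => ((n x : ℝ) ^ 2)⁻¹ * siteSq v x)
      fun x => mul_nonneg (inv_nonneg.mpr (sq_nonneg _)) (siteSq_nonneg v x)
  have hterm0 : ∀ b : UT N × Fin d, 0 ≤ 2 * Real.exp (2 * Φ₀) * (∑ i, (covD bsrc btgt c Rm v (b, i)) ^ 2 +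
      cmax ^ 2 * Real.exp 1 ^ 4 * κ ^ 2 * ((((n (btgt b) : ℝ)) ^ 2)⁻¹ * siteSq v (btgt b))) := by
    intro b
    have h1 : 0 ≤ ∑ i, (covD bsrc btgt c Rm v (b, i)) ^ 2 := Finset.sum_nonneg fun i _ => sq_nonneg _
    have h2 : 0 ≤ (((n (btgt b) : ℝ)) ^ 2)⁻¹ * siteSq v (btgt b) := mul_nonneg (inv_nonneg.mpr (sq_nonneg _)) (siteSq_nonneg v _)
    positivity
  calc ∑ b ∈ Bd, ∑ i, (covD bsrc btgt c Rm g (b, i)) ^ 2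
      ≤ ∑ b ∈ Bd, 2 * Real.exp (2 * Φ₀) * (∑ i, (covD bsrc btgt c Rm v (b, i)) ^ 2 +
          cmax ^ 2 * Real.exp 1 ^ 4 * κ ^ 2 * ((((n (btgt b) : ℝ)) ^ 2)⁻¹ * siteSq v (btgt b))) :=
        Finset.sum_le_sum fun b hb => hbond b hb
    _ ≤ ∑ b, 2 * Real.exp (2 * Φ₀) * (∑ i, (covD bsrc btgt c Rm v (b, i)) ^ 2 +
          cmax ^ 2 * Real.exp 1 ^ 4 * κ ^ 2 * ((((n (btgt b) : ℝ)) ^ 2)⁻¹ * siteSq v (btgt b))) :=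
        Finset.sum_le_sum_of_subset_of_nonneg (Finset.subset_univ Bd) fun b _ _ => hterm0 b
    _ = 2 * Real.exp (2 * Φ₀) * (∑ q, (covD bsrc btgt c Rm v q) ^ 2 +
          cmax ^ 2 * Real.exp 1 ^ 4 * κ ^ 2 * ∑ b : UT N × Fin d, ((n (btgt b) : ℝ) ^ 2)⁻¹ * siteSq v (btgt b)) := by
        rw [← Finset.mul_sum, Finset.sum_add_distrib, hsumD, ← Finset.mul_sum]
    _ ≤ 2 * Real.exp (2 * Φ₀) * (∑ q, (covD bsrc btgt c Rm v q) ^ 2 +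
          cmax ^ 2 * Real.exp 1 ^ 4 * κ ^ 2 * (d * ∑ x, ((n x : ℝ) ^ 2)⁻¹ * siteSq v x)) := by
        have hcoef : 0 ≤ cmax ^ 2 * Real.exp 1 ^ 4 * κ ^ 2 := by positivity
        have h1 := mul_le_mul_of_nonneg_left hfib hcoef
        have h2 : 0 ≤ 2 * Real.exp (2 * Φ₀) := by positivity
        exact mul_le_mul_of_nonneg_left (add_le_add le_rfl h1) h2

end ForwardSum

end

end Summit.QuantumFields.BalabanUV.Beta.MultiscaleGradientForward
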